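import Summits.Ventures.PercRepro.RankLevelSetUpFiveSeriesPair

/-! # RankLevelSetUpFiveSeriesPairBridge — THE TWO-ELEMENT RESIDUE (Θ) READ IN `N ＼ p'` (night-1 g42; dossier §54.4;
on `RankLevelSetUpFiveSeriesPair`)

For `N` on `12` elements with a parallel pair `cl {p} = {p, p'}` and `b ∈ E ∖ cl {p}`, the residue
`UpFiveSeriesPairTheta N p b` (`A_5 ≤ Ā_6 + ḡ_4^{sp}`) is, in the `11`-element deletion `N' := N ＼ {p'}`, the statement
«the bi-spanning `5`-sets of `N'` through `b` avoiding `p` are at most those through `p`»: `A_5` is the former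
family (**`upFull_eq_biSpan_delete`**), and `Ā_6 ⊔ ḡ_4^{sp}` is in bijection with the latter — `Z ↦ (E ∖ p') ∖ Z` on
the avoid-`b` part, `D ↦ insert p D` on the through-`b` part (**`avoidFull_ncard_eq`**, **`avoidSp_ncard_eq`**). Hence
**`upFiveSeriesPairTheta_iff_delete`**. Every declaration has a docstring; imports: the cell's own modules and
Mathlib only. Axioms: standard. -/

namespace PercRepro

open Set Matroid

variable {α : Type} (N : Matroid α) [N.Finite]

/-- **The parallel class of `p` of size two is `{p, p'}`.** -/
lemma closure_eq_pair_of_ncard_two {p p' : α} (hp : p ∈ N.E) (hp' : p' ∈ N.closure {p}) (hpp : p' ≠ p)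
    (hq : (N.closure {p}).ncard = 2) : N.closure {p} = {p, p'} := by
  have hsub : ({p, p'} : Set α) ⊆ N.closure {p} := by
    intro x hx
    rcases hx with rfl | hx
    · exact N.mem_closure_of_mem' rfl hp
    · rw [Set.mem_singleton_iff] at hx; rw [hx]; exact hp'
  have hfin : (N.closure {p}).Finite := N.ground_finite.subset (N.closure_subset_ground _)
  refine (Set.eq_of_subset_of_ncard_le hsub ?_ hfin).symm
  rw [hq, Set.ncard_pair hpp.symm]

omit [N.Finite] in
/-- **Spanning in `N ＼ {p'}` is spanning in `N` for sets avoiding `p'`** (`{p'}` is coindependent: `p ∥ p'`). -/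
lemma delete_parallel_spanning_iff {p p' : α} (hp : p ∈ N.E) (hp' : p' ∈ N.closure {p}) (hpp : p' ≠ p)
    {X : Set α} (hX : p' ∉ X) : (N.delete {p'}).Spanning X ↔ N.Spanning X := by
  refine delete_spanning_iff_of_disjoint N ?_ (Set.disjoint_singleton_right.mpr hX)
  exact coindep_of_subset_closure_of_notMem N hp (Set.singleton_subset_iff.mpr hp') (by simpa using hpp.symm)

omit [N.Finite] in
/-- `(E ∖ {p'}) ∖ X = insert p ((E ∖ {p, p'}) ∖ X)` for `X ⊆ E ∖ {p, p'}`. -/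
lemma sdiff_pair_eq_insert {p p' : α} (hp : p ∈ N.E) (hpp : p' ≠ p) {X : Set α} (hX : X ⊆ N.E \ {p, p'}) :
    (N.E \ {p'}) \ X = insert p ((N.E \ {p, p'}) \ X) := by
  ext x
  simp only [Set.mem_sdiff, Set.mem_singleton_iff, Set.mem_insert_iff, not_or]
  constructor
  · rintro ⟨⟨hxE, hxp'⟩, hxX⟩
    by_cases hxp : x = p
    · exact Or.inl hxp
    · exact Or.inr ⟨⟨hxE, hxp, hxp'⟩, hxX⟩
  · rintro (rfl | ⟨⟨hxE, hxp, hxp'⟩, hxX⟩)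
    · exact ⟨⟨hp, hpp.symm⟩, fun h => (hX h).2 (Or.inl rfl)⟩
    · exact ⟨⟨hxE, hxp'⟩, hxX⟩

omit [N.Finite] in
/-- `p'` is not in `insert p ((E ∖ {p, p'}) ∖ X)`. -/
lemma notMem_insert_sdiff_pair {p p' : α} (hpp : p' ≠ p) (X : Set α) :
    p' ∉ insert p ((N.E \ {p, p'}) \ X) := by
  rintro (h | h)
  · exact hpp h
  · exact h.1.2 (Or.inr rfl)

/-- **`A_5 = upFull N p b 5` is the family of bi-spanning `5`-sets of `N ＼ {p'}` through `b` avoiding `p`.** -/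
lemma upFull_eq_biSpan_delete {p p' : α} (hp : p ∈ N.E) (hp' : p' ∈ N.closure {p}) (hpp : p' ≠ p)
    (hq : (N.closure {p}).ncard = 2) (b : α) :
    upFull N p b 5 = {B ∈ biSpan (N.delete {p'}) 5 | b ∈ B ∧ p ∉ B} := by
  have hP := closure_eq_pair_of_ncard_two N hp hp' hpp hq
  ext W
  simp only [upFull, biSpan, Set.mem_setOf_eq, Matroid.delete_ground, hP]
  constructor
  · rintro ⟨hWE, hW5, hbW, hWs, hWc⟩
    have hpW : p ∉ W := fun h => (hWE h).2 (Or.inl rfl)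
    have hp'W : p' ∉ W := fun h => (hWE h).2 (Or.inr rfl)
    refine ⟨⟨fun x hx => ⟨(hWE hx).1, fun h => (hWE hx).2 (Or.inr h)⟩, hW5, ?_, ?_⟩, hbW, hpW⟩
    · exact (delete_parallel_spanning_iff N hp hp' hpp hp'W).mpr hWs
    · rw [sdiff_pair_eq_insert N hp hpp hWE]
      exact (delete_parallel_spanning_iff N hp hp' hpp (notMem_insert_sdiff_pair N hpp W)).mpr hWc
  · rintro ⟨⟨hWE, hW5, hWs, hWc⟩, hbW, hpW⟩
    have hp'W : p' ∉ W := fun h => (hWE h).2 rfl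
    have hWE' : W ⊆ N.E \ {p, p'} := by
      intro x hx
      refine ⟨(hWE hx).1, ?_⟩
      rintro (h | h)
      · exact hpW (h ▸ hx)
      · exact (hWE hx).2 h
    refine ⟨hWE', hW5, hbW, ?_, ?_⟩
    · exact (delete_parallel_spanning_iff N hp hp' hpp hp'W).mp hWs
    · rw [sdiff_pair_eq_insert N hp hpp hWE'] at hWc
      exact (delete_parallel_spanning_iff N hp hp' hpp (notMem_insert_sdiff_pair N hpp W)).mp hWc

/-- **`Ā_6` counts the bi-spanning `5`-sets of `N ＼ {p'}` through `p` and `b`** (`#E = 12`): `Z ↦ (E ∖ p') ∖ Z`. -/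
lemma avoidFull_ncard_eq {p p' : α} (hp : p ∈ N.E) (hp' : p' ∈ N.closure {p}) (hpp : p' ≠ p)
    (hq : (N.closure {p}).ncard = 2) (hn : N.E.ncard = 12) {b : α} (hb : b ∈ N.E) (hbP : b ∉ N.closure {p}) :
    (avoidFull N p b 6).ncard = {B ∈ biSpan (N.delete {p'}) 5 | p ∈ B ∧ b ∈ B}.ncard := by
  have hP := closure_eq_pair_of_ncard_two N hp hp' hpp hq
  have hPE : ({p, p'} : Set α) ⊆ N.E := by rw [← hP]; exact N.closure_subset_ground _
  have hp'E : p' ∈ N.E := hPE (Or.inr rfl)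
  have hbpair : b ∉ ({p, p'} : Set α) := by rwa [← hP]
  have hE1fin : (N.E \ {p'}).Finite := N.ground_finite.subset Set.sdiff_subset
  have hE0fin : (N.E \ {p, p'}).Finite := N.ground_finite.subset Set.sdiff_subset
  have hE0 : (N.E \ {p, p'}).ncard = 10 := by
    rw [Set.ncard_sdiff' hPE N.ground_finite, hn, Set.ncard_pair hpp.symm]
  have hE1 : (N.E \ {p'}).ncard = 11 := by
    rw [Set.ncard_sdiff' (Set.singleton_subset_iff.mpr hp'E) N.ground_finite, hn, Set.ncard_singleton]
  have hsub01 : N.E \ {p, p'} ⊆ N.E \ {p'} := Set.sdiff_subset_sdiff_right (fun x hx => Or.inr hx)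
  refine Set.ncard_congr (fun Z _ => (N.E \ {p'}) \ Z) ?_ ?_ ?_
  · rintro Z ⟨hZE, hZ6, hbZ, hZs, hZc⟩
    rw [hP] at hZE hZc
    have hpZ : p ∉ Z := fun h => (hZE h).2 (Or.inl rfl)
    refine ⟨⟨Set.sdiff_subset, ?_, ?_, ?_⟩, ⟨⟨hp, fun h => hpp.symm h⟩, hpZ⟩, ⟨⟨hb, fun h => hbpair (Or.inr h)⟩, hbZ⟩⟩
    · rw [sdiff_pair_eq_insert N hp hpp hZE, Set.ncard_insert_of_notMem (fun h => h.1.2 (Or.inl rfl))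
        (hE0fin.subset Set.sdiff_subset), Set.ncard_sdiff' hZE hE0fin, hE0, hZ6]
    · rw [sdiff_pair_eq_insert N hp hpp hZE]
      exact (delete_parallel_spanning_iff N hp hp' hpp (notMem_insert_sdiff_pair N hpp Z)).mpr hZc
    · rw [Matroid.delete_ground, Set.sdiff_sdiff_cancel_left (hZE.trans hsub01)]
      exact (delete_parallel_spanning_iff N hp hp' hpp (fun h => (hZE h).2 (Or.inr rfl))).mpr hZs
  · rintro Z Z' ⟨hZE, -, -, -, -⟩ ⟨hZ'E, -, -, -, -⟩ heq
    rw [hP] at hZE hZ'E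
    have h1 : (N.E \ {p'}) \ ((N.E \ {p'}) \ Z) = (N.E \ {p'}) \ ((N.E \ {p'}) \ Z') := by rw [heq]
    rwa [Set.sdiff_sdiff_cancel_left (hZE.trans hsub01), Set.sdiff_sdiff_cancel_left (hZ'E.trans hsub01)] at h1
  · rintro B ⟨⟨hBE, hB5, hBs, hBc⟩, hpB, hbB⟩
    rw [Matroid.delete_ground] at hBE hBc
    refine ⟨(N.E \ {p'}) \ B, ?_, Set.sdiff_sdiff_cancel_left hBE⟩
    have hZE : (N.E \ {p'}) \ B ⊆ N.E \ {p, p'} := by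
      rintro x ⟨⟨hxE, hxp'⟩, hxB⟩
      refine ⟨hxE, ?_⟩
      rintro (h | h)
      · exact hxB (h ▸ hpB)
      · exact hxp' h
    have hZ6 : ((N.E \ {p'}) \ B).ncard = 6 := by
      rw [Set.ncard_sdiff' hBE hE1fin, hE1, hB5]
    have hcompl : (N.E \ {p, p'}) \ ((N.E \ {p'}) \ B) = B \ {p} := by
      ext x
      simp only [Set.mem_sdiff, Set.mem_singleton_iff, Set.mem_insert_iff, not_or, not_and, not_not]
      constructor
      · rintro ⟨⟨hxE, hxp, hxp'⟩, h⟩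
        exact ⟨h ⟨hxE, hxp'⟩, hxp⟩
      · rintro ⟨hxB, hxp⟩
        have hxE := hBE hxB
        exact ⟨⟨hxE.1, hxp, hxE.2⟩, fun _ => hxB⟩
    refine ⟨by rw [hP]; exact hZE, hZ6, fun h => h.2 hbB, ?_, ?_⟩
    · exact (delete_parallel_spanning_iff N hp hp' hpp (fun h => h.1.2 rfl)).mp hBc
    · rw [hP, hcompl, Set.insert_sdiff_singleton, Set.insert_eq_of_mem hpB]
      exact (delete_parallel_spanning_iff N hp hp' hpp (fun h => (hBE h).2 rfl)).mp hBs

/-- **`ḡ_4^{sp}` counts the bi-spanning `5`-sets of `N ＼ {p'}` through `p` avoiding `b`**: `D ↦ insert p D`. -/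
lemma avoidSp_ncard_eq {p p' : α} (hp : p ∈ N.E) (hp' : p' ∈ N.closure {p}) (hpp : p' ≠ p)
    (hq : (N.closure {p}).ncard = 2) {b : α} (hbP : b ∉ N.closure {p}) :
    (avoidSp N p b 4).ncard = {B ∈ biSpan (N.delete {p'}) 5 | p ∈ B ∧ b ∉ B}.ncard := by
  have hP := closure_eq_pair_of_ncard_two N hp hp' hpp hq
  have hbpair : b ∉ ({p, p'} : Set α) := by rwa [← hP]
  have hbp : b ≠ p := fun h => hbpair (Or.inl h)
  have hE0fin : (N.E \ {p, p'}).Finite := N.ground_finite.subset Set.sdiff_subset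
  have hsub01 : N.E \ {p, p'} ⊆ N.E \ {p'} := Set.sdiff_subset_sdiff_right (fun x hx => Or.inr hx)
  have hins : ∀ {D : Set α}, D ⊆ N.E \ {p, p'} → (N.E \ {p'}) \ insert p D = (N.E \ {p, p'}) \ D := by
    intro D hD
    ext x
    simp only [Set.mem_sdiff, Set.mem_singleton_iff, Set.mem_insert_iff, not_or]
    tauto
  refine Set.ncard_congr (fun D _ => insert p D) ?_ ?_ ?_
  · rintro D ⟨hDE, hD4, hbD, hDs, hDc⟩
    rw [hP] at hDE hDc
    have hpD : p ∉ D := fun h => (hDE h).2 (Or.inl rfl)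
    refine ⟨⟨?_, ?_, ?_, ?_⟩, Set.mem_insert p D, ?_⟩
    · exact Set.insert_subset ⟨hp, fun h => hpp.symm h⟩ (hDE.trans hsub01)
    · rw [Set.ncard_insert_of_notMem hpD (hE0fin.subset hDE), hD4]
    · exact (delete_parallel_spanning_iff N hp hp' hpp (fun h => by
        rcases h with h | h
        · exact hpp h
        · exact (hDE h).2 (Or.inr rfl))).mpr hDs
    · rw [Matroid.delete_ground, hins hDE]
      exact (delete_parallel_spanning_iff N hp hp' hpp (fun h => h.1.2 (Or.inr rfl))).mpr hDc
    · rintro (h | h)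
      · exact hbp h
      · exact hbD h
  · rintro D D' ⟨hDE, -, -, -, -⟩ ⟨hD'E, -, -, -, -⟩ heq
    rw [hP] at hDE hD'E
    have hpD : p ∉ D := fun h => (hDE h).2 (Or.inl rfl)
    have hpD' : p ∉ D' := fun h => (hD'E h).2 (Or.inl rfl)
    have h1 : insert p D \ {p} = insert p D' \ {p} := by rw [heq]
    rwa [Set.insert_sdiff_self_of_notMem hpD, Set.insert_sdiff_self_of_notMem hpD'] at h1
  · rintro B ⟨⟨hBE, hB5, hBs, hBc⟩, hpB, hbB⟩
    rw [Matroid.delete_ground] at hBE hBc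
    have hDE : B \ {p} ⊆ N.E \ {p, p'} := by
      rintro x ⟨hxB, hxp⟩
      refine ⟨(hBE hxB).1, ?_⟩
      rintro (h | h)
      · exact hxp h
      · exact (hBE hxB).2 h
    have hBeq : insert p (B \ {p}) = B := Set.insert_sdiff_singleton.trans (Set.insert_eq_of_mem hpB)
    refine ⟨B \ {p}, ⟨by rw [hP]; exact hDE, ?_, fun h => hbB h.1, ?_, ?_⟩, hBeq⟩
    · rw [Set.ncard_sdiff_singleton_of_mem hpB, hB5]
    · rw [hBeq]
      exact (delete_parallel_spanning_iff N hp hp' hpp (fun h => (hBE h).2 rfl)).mp hBs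
    · rw [hP, ← hins hDE, hBeq]
      exact (delete_parallel_spanning_iff N hp hp' hpp (fun h => h.1.2 rfl)).mp hBc

/-- **THE TWO-ELEMENT RESIDUE IN `N ＼ {p'}`** (`#E = 12`, `cl {p} = {p, p'}`, `b ∈ E ∖ cl {p}`):
`UpFiveSeriesPairTheta N p b ↔ #{B ∈ biSpan (N ＼ p') 5 : b ∈ B, p ∉ B} ≤ #{B ∈ biSpan (N ＼ p') 5 : p ∈ B}`. -/
theorem upFiveSeriesPairTheta_iff_delete {p p' : α} (hp : p ∈ N.E) (hp' : p' ∈ N.closure {p}) (hpp : p' ≠ p)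
    (hq : (N.closure {p}).ncard = 2) (hn : N.E.ncard = 12) {b : α} (hb : b ∈ N.E) (hbP : b ∉ N.closure {p}) :
    UpFiveSeriesPairTheta N p b ↔
      {B ∈ biSpan (N.delete {p'}) 5 | b ∈ B ∧ p ∉ B}.ncard ≤ {B ∈ biSpan (N.delete {p'}) 5 | p ∈ B}.ncard := by
  classical
  unfold UpFiveSeriesPairTheta
  rw [upFull_eq_biSpan_delete N hp hp' hpp hq b, avoidFull_ncard_eq N hp hp' hpp hq hn hb hbP,
    avoidSp_ncard_eq N hp hp' hpp hq hbP]
  have hfin : {B ∈ biSpan (N.delete {p'}) 5 | p ∈ B}.Finite :=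
    (N.delete {p'}).ground_finite.finite_subsets.subset (fun _ h => h.1.1)
  have hsplit : {B ∈ biSpan (N.delete {p'}) 5 | p ∈ B}.ncard =
      {B ∈ biSpan (N.delete {p'}) 5 | p ∈ B ∧ b ∈ B}.ncard +
        {B ∈ biSpan (N.delete {p'}) 5 | p ∈ B ∧ b ∉ B}.ncard := by
    rw [← Set.ncard_union_eq (Set.disjoint_left.mpr (fun B h1 h2 => h2.2.2 h1.2.2))
      (hfin.subset (fun _ h => ⟨h.1, h.2.1⟩)) (hfin.subset (fun _ h => ⟨h.1, h.2.1⟩))]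
    congr 1
    ext B
    simp only [Set.mem_union, Set.mem_setOf_eq]
    tauto
  rw [hsplit]

end PercRepro
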